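import Summits.HubbardSuperconductivity.HubbardSuperconductivity.Theorems.AnisotropyChordTransferFibre3GroundExists

/-!
# Route `AnisotropyChord` / H0 rotor rung: UNIQUENESS OF THE GROUND TWO-MAGNON PROFILE (`IsGroundTwoMagnon` is a singleton, `L ≥ 2`)

Companion of `exists_isGroundTwoMagnon` (`…Fibre3GroundExists`): for `L ≥ 2` and any real `Δ`, the data
`(λ₂, f)` with `IsGroundTwoMagnon L Δ λ₂ f` are UNIQUE — **`ground_unique`**: `λ₂ = λ₂'` (both are the constrained minimum,
attained) and `f = f'` (Perron–Frobenius: `h = f − f'` solves the Euler–Lagrange equations with `Σ h = 0`; `|h|` is a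
minimiser, so `h⁺ = (|h| + h)/2` and `h⁻ = (|h| − h)/2` are non-negative minimisers; a non-negative minimiser with one zero off
the origin vanishes identically (`zero_spreads`), so `h` cannot take both signs, hence `h = 0`).
So «the» ground profile of the GM₃ assembly is well defined; every seat's witness is the same function.
Prover seat `hubbard-h0-rotor-p1` g23; helper for stmt-HubbardSuperconductivity-19089 (`--supports`).
-/

set_option linter.dupNamespace false
set_option autoImplicit false

noncomputable section

open scoped BigOperators

namespace Summit.HubbardSuperconductivity.HubbardSuperconductivity.Theorems.AnisotropyChord.Transfer.Fibre3

variable (L : ℕ) [NeZero L]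

/-- the eigenvalue of a ground profile is the constrained minimum, hence unique. [folklore] -/
theorem ground_lam2_unique (hL : 2 ≤ L) {Δ lam2 lam2' : ℝ} {f g : Tor L → ℝ}
    (hf : IsGroundTwoMagnon L Δ lam2 f) (hg : IsGroundTwoMagnon L Δ lam2' g) : lam2 = lam2' := by
  have hK : K1 L ≠ 0 := K1_ne_zero L hL
  have key : ∀ {l l' : ℝ} {u v : Tor L → ℝ}, IsGroundTwoMagnon L Δ l u → IsGroundTwoMagnon L Δ l' v → l ≤ l' := by
    intro l l' u v hu hv
    have hQv : twoMagnonQF L Δ v = l' * ∑ r : Tor L, v r ^ 2 := twoMagnonQF_of_isTwoMagnon L hv.1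
    have hmin := hu.2.2 v hv.1.1
    rw [hQv] at hmin
    have hpos : 0 < ∑ r : Tor L, v r ^ 2 :=
      lt_of_lt_of_le (pow_pos hv.1.2.2.1 2) (Finset.single_le_sum (fun r _ => sq_nonneg (v r)) (Finset.mem_univ (K1 L)))
    exact le_of_mul_le_mul_right hmin hpos
  exact le_antisymm (key hf hg) (key hg hf)

/-- a ground profile solves the Euler–Lagrange equations of `…Fibre3GroundVariational`. [folklore] -/
theorem ground_EL {Δ lam2 : ℝ} {f : Tor L → ℝ} (hf : IsTwoMagnon L Δ lam2 f) :
    ∀ r : Tor L, r ≠ 0 → tmOp L Δ f r = lam2 * f r := fun r hr => twoMagnon_eq_nbSum L hf r hr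

/-- ★ **UNIQUENESS of the ground two-magnon profile** (`L ≥ 2`): `IsGroundTwoMagnon L Δ λ₂ f` and
`IsGroundTwoMagnon L Δ λ₂' g` force `λ₂ = λ₂'` and `f = g`. [folklore] -/
theorem ground_unique (hL : 2 ≤ L) {Δ lam2 lam2' : ℝ} {f g : Tor L → ℝ}
    (hf : IsGroundTwoMagnon L Δ lam2 f) (hg : IsGroundTwoMagnon L Δ lam2' g) : lam2 = lam2' ∧ f = g := by
  have hl : lam2 = lam2' := ground_lam2_unique L hL hf hg
  subst hl
  refine ⟨rfl, ?_⟩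
  obtain ⟨hft, -, hmin⟩ := hf
  obtain ⟨hgt, -, -⟩ := hg
  -- `h = f − g`: EL solution, zero at the origin, zero sum
  set h : Tor L → ℝ := fun r => f r + (-1) * g r with hh
  have hELf := ground_EL L hft
  have hELg := ground_EL L hgt
  have hELh : ∀ r : Tor L, r ≠ 0 → tmOp L Δ h r = lam2 * h r := EL_add L hELf (EL_smul L hELg (-1))
  have hz : h 0 = 0 := by simp [hh, hft.1, hgt.1]
  have hsum : ∑ r : Tor L, h r = 0 := by
    simp only [hh, Finset.sum_add_distrib, ← Finset.mul_sum, hft.2.2.2.1, hgt.2.2.2.1]; ring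
  have hQh := qf_of_EL L hz hELh
  -- `|h|` is a minimiser, hence an EL solution
  set k : Tor L → ℝ := fun r => |h r| with hk
  have hkz : k 0 = 0 := by simp [hk, hz]
  have hQk : twoMagnonQF L Δ k = lam2 * ∑ r : Tor L, k r ^ 2 := by
    have hle := qf_abs_le L Δ h
    have hge := hmin k hkz
    have hsq : ∑ r : Tor L, k r ^ 2 = ∑ r : Tor L, h r ^ 2 := Finset.sum_congr rfl fun r _ => sq_abs (h r)
    rw [hsq] at hge ⊢
    have hle' : twoMagnonQF L Δ k ≤ twoMagnonQF L Δ h := hle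
    linarith
  have hELk : ∀ r : Tor L, r ≠ 0 → tmOp L Δ k r = lam2 * k r := EL_of_min L hmin hkz hQk
  -- the positive and negative parts are non-negative EL solutions
  set hp : Tor L → ℝ := fun r => (1 / 2) * (k r + h r) with hhp
  set hm : Tor L → ℝ := fun r => (1 / 2) * (k r + (-1) * h r) with hhm
  have hELp : ∀ r : Tor L, r ≠ 0 → tmOp L Δ hp r = lam2 * hp r := EL_smul L (EL_add L hELk hELh) (1 / 2)
  have hELm : ∀ r : Tor L, r ≠ 0 → tmOp L Δ hm r = lam2 * hm r :=
    EL_smul L (EL_add L hELk (EL_smul L hELh (-1))) (1 / 2)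
  have hp0 : ∀ r, 0 ≤ hp r := fun r => by
    simp only [hhp, hk]; nlinarith [le_abs_self (h r), neg_abs_le (h r)]
  have hm0 : ∀ r, 0 ≤ hm r := fun r => by
    simp only [hhm, hk]; nlinarith [le_abs_self (h r), neg_abs_le (h r)]
  have hpz : hp 0 = 0 := by simp [hhp, hkz, hz]
  have hmz : hm 0 = 0 := by simp [hhm, hkz, hz]
  have hQp := qf_of_EL L hpz hELp
  have hQm := qf_of_EL L hmz hELm
  -- if `h ≠ 0` it takes both signs (zero sum), contradiction with `zero_spreads`
  funext r₀
  by_contra hne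
  have hne' : h r₀ ≠ 0 := by
    simp only [hh]; intro e; apply hne; linarith
  -- a site where `h > 0` and a site where `h < 0`
  obtain ⟨r₁, hr₁⟩ : ∃ r, 0 < h r := by
    by_contra hno
    have hno' : ∀ r, h r ≤ 0 := fun r => le_of_not_gt (fun h' => hno ⟨r, h'⟩)
    have hall : ∀ r, h r = 0 := fun r =>
      (Finset.sum_eq_zero_iff_of_nonpos (fun s _ => hno' s)).1 hsum r (Finset.mem_univ r)
    exact hne' (hall r₀)
  obtain ⟨r₂, hr₂⟩ : ∃ r, h r < 0 := by
    by_contra hno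
    have hno' : ∀ r, 0 ≤ h r := fun r => le_of_not_gt (fun h' => hno ⟨r, h'⟩)
    have hall : ∀ r, h r = 0 := fun r =>
      (Finset.sum_eq_zero_iff_of_nonneg (fun s _ => hno' s)).1 hsum r (Finset.mem_univ r)
    exact hne' (hall r₀)
  have hr₂0 : r₂ ≠ 0 := fun e => by rw [e, hz] at hr₂; exact lt_irrefl _ hr₂
  have hpr₂ : hp r₂ = 0 := by
    simp only [hhp, hk]; rw [abs_of_neg hr₂]; ring
  have hzero := zero_spreads L hL hp0 hmin hQp hpz hr₂0 hpr₂ r₁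
  have : hp r₁ = h r₁ := by
    simp only [hhp, hk]; rw [abs_of_pos hr₁]; ring
  rw [this] at hzero
  exact absurd hzero hr₁.ne'

end Summit.HubbardSuperconductivity.HubbardSuperconductivity.Theorems.AnisotropyChord.Transfer.Fibre3

end
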